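import Mathlib.LinearAlgebra.Matrix.Transvection
import Mathlib.LinearAlgebra.Matrix.ToLinearEquiv
import Mathlib.LinearAlgebra.Matrix.CharP
import Mathlib.Algebra.CharP.Lemmas
import Mathlib.FieldTheory.Finite.Basic
import HarnessLib

/-!
# Dickson / Serre (1972) §2.4 Prop. 15, the part used for Galois images: two transvections with distinct
# axes and a full determinant generate `GL₂(𝔽_p)`; an element of order `p` of `GL₂(𝔽_p)` is a transvection

Topic `GroupTheory`; namespace `Literature.GroupTheory.DicksonGL2`.  THEOREMS ONLY (no definition, no named
fact, no `sorry`), elementary `2 × 2` matrix algebra — everything here is PROVED, the citation is a locator.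

Serre, *Propriétés galoisiennes des points d'ordre fini des courbes elliptiques*, Invent. Math. 15 (1972),
§2.4, Prop. 15: "Soit `G` un sous-groupe de `GL(V)` d'ordre divisible par `p` [`V` a plane over `𝔽_p`].
Alors, ou bien `G` contient `SL(V)`, ou bien `G` est contenu dans un sous-groupe de Borel de `GL(V)`"
(Dickson).  The proof: an element of order `p` is a transvection; if all transvections of `G` share their
axis, `G` normalises that line (Borel); otherwise two transvections with distinct axes generate `SL(V)`.
This file proves the matrix statements a consumer needs to run that argument on a Galois image
`ρ̄ : Γ → GL₂(𝔽_p)` (BSD cell `bsd-addord`, crux `GordTwoRankOne`, small-image rows: «`E[p]` irreducible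
and `ρ̄_{E,p}` not onto ⟹ `p ∤ #ρ̄_{E,p}(Γ_ℚ)`», file
`Summits/BirchSwinnertonDyer/BirchSwinnertonDyer/Theorems/AdditiveBranchIMCGordTwoRankOneSmallImageDickson`):

* `exists_word_of_det_eq_one_of_ne_zero`, `exists_word_of_det_eq_one` — over any field, every matrix of
  determinant `1` is a word `L(a) · U(r) · L(c) · U(s)` in upper (`U = T₀₁`) and lower (`L = T₁₀`)
  unipotents (explicit decomposition, `a ∈ {0, -1}`) — «the transvections generate `SL(V)`»;
* `eq_transvection_of_upper_of_pow_eq_one` (and the lower twin) — over `𝔽_p`, a matrix fixing `e₀`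
  (first column `(1, 0)`) with `M^p = 1` is the transvection `U(M₀₁)` (its diagonal entry `d` has
  `d^p = d = 1`);
* `exists_mulVec_eq_self_of_pow_eq_one` — over `𝔽_p`, `M^p = 1 ⟹ M` fixes a non-zero vector
  (`(M − 1)^p = M^p − 1 = 0`, so `det(M − 1) = 0`);
* ★ `forall_exists_eq_of_transvections` — for a multiplicative map `ρ : G → M₂(𝔽_p)` from a group whose
  image contains `U(x)`, `L(w)` with `x, w ≠ 0` and meets every non-zero determinant, EVERY invertible matrix
  is in the image (all `U(t)`, `L(t)` are powers; `SL₂` by the word decomposition; then adjust the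
  determinant).
Private plumbing ([folklore]): `transvection_pow`, the explicit `2 × 2` forms, `pow_apply_of_upper/lower`,
`exists_nsmul_eq`.

References: J.-P. Serre, Invent. Math. 15 (1972) 259–331, §2.4 Prop. 15 [Serre1972]; L. E. Dickson,
*Linear Groups* (1901), Ch. XII [Dickson1901].
-/

namespace Literature.GroupTheory.DicksonGL2

open Matrix

/-! ## §1 Unipotent words over a field -/

section Field

variable {k : Type*} [Field k]

/-- `T_{ij}(c)^n = T_{ij}(n • c)` (`i ≠ j`) (plumbing). [folklore] -/
private theorem transvection_pow {n : Type*} [DecidableEq n] [Fintype n] {R : Type*} [CommRing R] {i j : n}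
    (h : i ≠ j) (c : R) (m : ℕ) : transvection i j c ^ m = transvection i j (m • c) := by
  induction m with
  | zero => rw [pow_zero, zero_smul, transvection_zero]
  | succ m ih => rw [pow_succ, ih, transvection_mul_transvection_same _ _ h, succ_nsmul]

/-- The upper unipotent `U(r) = T₀₁(r)` as an explicit `2 × 2` matrix (plumbing). [folklore] -/
private theorem transvection_zero_one_eq (r : k) : transvection (0 : Fin 2) 1 r = !![1, r; 0, 1] := by
  ext i j
  fin_cases i <;> fin_cases j <;> simp [transvection, Matrix.single]

/-- The lower unipotent `L(c) = T₁₀(c)` as an explicit `2 × 2` matrix (plumbing). [folklore] -/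
private theorem transvection_one_zero_eq (c : k) : transvection (1 : Fin 2) 0 c = !![1, 0; c, 1] := by
  ext i j
  fin_cases i <;> fin_cases j <;> simp [transvection, Matrix.single]

/-- `U(r) · L(c) · U(s) = (1 + rc, s + r(cs + 1); c, cs + 1)` (plumbing). [folklore] -/
private theorem transvection_mul_mul_eq (r c s : k) :
    transvection (0 : Fin 2) 1 r * transvection (1 : Fin 2) 0 c * transvection (0 : Fin 2) 1 s =
      !![1 + r * c, s + r * (c * s + 1); c, c * s + 1] := by
  rw [transvection_zero_one_eq, transvection_zero_one_eq, transvection_one_zero_eq]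
  simp only [Matrix.mul_fin_two]
  congr 1
  ring

/-- **A matrix of determinant `1` with non-zero lower-left entry is `U(r) · L(c) · U(s)`** with
`c = M₁₀`, `r = (M₀₀ − 1)/c`, `s = (M₁₁ − 1)/c` — the generation step «the transvections generate `SL(V)`»
of Serre's proof of Prop. 15, made explicit (Dickson, *Linear Groups*, Ch. XII).
[cite: Serre1972, §2.4 (proof of Prop. 15)] [cite: Dickson1901, Ch. XII] -/
theorem exists_word_of_det_eq_one_of_ne_zero (M : Matrix (Fin 2) (Fin 2) k) (hM : M.det = 1)
    (h10 : M 1 0 ≠ 0) :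
    ∃ r c s : k, M = transvection (0 : Fin 2) 1 r * transvection (1 : Fin 2) 0 c *
      transvection (0 : Fin 2) 1 s := by
  refine ⟨(M 0 0 - 1) / M 1 0, M 1 0, (M 1 1 - 1) / M 1 0, ?_⟩
  rw [transvection_mul_mul_eq]
  rw [Matrix.det_fin_two] at hM
  ext i j
  fin_cases i <;> fin_cases j
  · simp only [Fin.zero_eta, Fin.isValue, of_apply, cons_val', cons_val_zero, cons_val_fin_one]
    field_simp
    ring
  · simp only [Fin.zero_eta, Fin.isValue, Fin.mk_one, of_apply, cons_val', cons_val_one,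
      cons_val_fin_one, cons_val_zero]
    field_simp
    linear_combination -hM
  · simp
  · simp only [Fin.mk_one, Fin.isValue, of_apply, cons_val', cons_val_one, cons_val_fin_one]
    field_simp
    ring

/-- **Every matrix of determinant `1` over a field is a word `L(a) · U(r) · L(c) · U(s)` in the upper
and lower unipotents** (`a = 0` if `M₁₀ ≠ 0`, else `a = -1` after replacing `M` by `L(1) · M`): the upper
and lower unipotent subgroups generate `SL₂(k)` (generation step of Serre's proof of Prop. 15; Dickson Ch. XII).
[cite: Serre1972, §2.4 (proof of Prop. 15)] [cite: Dickson1901, Ch. XII] -/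
theorem exists_word_of_det_eq_one (M : Matrix (Fin 2) (Fin 2) k) (hM : M.det = 1) :
    ∃ a r c s : k, M = transvection (1 : Fin 2) 0 a * (transvection (0 : Fin 2) 1 r *
      transvection (1 : Fin 2) 0 c * transvection (0 : Fin 2) 1 s) := by
  by_cases h10 : M 1 0 ≠ 0
  · obtain ⟨r, c, s, h⟩ := exists_word_of_det_eq_one_of_ne_zero M hM h10
    exact ⟨0, r, c, s, by rw [transvection_zero, Matrix.one_mul]; exact h⟩
  · push Not at h10
    -- `N := L(1) · M` has lower-left entry `M₀₀ ≠ 0`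
    have hdet' : (transvection (1 : Fin 2) 0 (1 : k) * M).det = 1 := by
      rw [Matrix.det_mul, det_transvection_of_ne _ _ (by decide), one_mul, hM]
    have h00 : M 0 0 ≠ 0 := by
      intro h0
      rw [Matrix.det_fin_two, h0, h10, zero_mul, mul_zero, sub_zero] at hM
      exact zero_ne_one hM
    have hN10 : (transvection (1 : Fin 2) 0 (1 : k) * M) 1 0 ≠ 0 := by
      rw [transvection_mul_apply_same, h10, one_mul, zero_add]
      exact h00
    obtain ⟨r, c, s, h⟩ := exists_word_of_det_eq_one_of_ne_zero _ hdet' hN10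
    refine ⟨-1, r, c, s, ?_⟩
    rw [← h, ← Matrix.mul_assoc, transvection_mul_transvection_same _ _ (by decide), neg_add_cancel,
      transvection_zero, Matrix.one_mul]

end Field

/-! ## §2 Over `𝔽_p`: elements of order `p`, and generation of `GL₂(𝔽_p)` -/

section ZMod

variable {p : ℕ} [hp : Fact p.Prime]

/-- Powers of an upper-triangular `2 × 2` matrix with `M₀₀ = 1`: `(M^n)₁₀ = 0`, `(M^n)₀₀ = 1`,
`(M^n)₁₁ = M₁₁^n` (plumbing). [folklore] -/
private theorem pow_apply_of_upper {R : Type*} [CommRing R] (M : Matrix (Fin 2) (Fin 2) R) (h10 : M 1 0 = 0)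
    (h00 : M 0 0 = 1) (n : ℕ) : (M ^ n) 1 0 = 0 ∧ (M ^ n) 0 0 = 1 ∧ (M ^ n) 1 1 = M 1 1 ^ n := by
  induction n with
  | zero => simp
  | succ n ih =>
    obtain ⟨h1, h2, h3⟩ := ih
    refine ⟨?_, ?_, ?_⟩
    · rw [pow_succ, Matrix.mul_apply, Fin.sum_univ_two, h1, h10, zero_mul, mul_zero, add_zero]
    · rw [pow_succ, Matrix.mul_apply, Fin.sum_univ_two, h2, h00, h10, mul_zero, add_zero, mul_one]
    · rw [pow_succ, Matrix.mul_apply, Fin.sum_univ_two, h1, h3, zero_mul, zero_add, pow_succ]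

/-- Powers of a lower-triangular `2 × 2` matrix with `M₁₁ = 1`: `(M^n)₀₁ = 0`, `(M^n)₁₁ = 1`,
`(M^n)₀₀ = M₀₀^n` (plumbing). [folklore] -/
private theorem pow_apply_of_lower {R : Type*} [CommRing R] (M : Matrix (Fin 2) (Fin 2) R) (h01 : M 0 1 = 0)
    (h11 : M 1 1 = 1) (n : ℕ) : (M ^ n) 0 1 = 0 ∧ (M ^ n) 1 1 = 1 ∧ (M ^ n) 0 0 = M 0 0 ^ n := by
  induction n with
  | zero => simp
  | succ n ih =>
    obtain ⟨h1, h2, h3⟩ := ih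
    refine ⟨?_, ?_, ?_⟩
    · rw [pow_succ, Matrix.mul_apply, Fin.sum_univ_two, h1, h01, mul_zero, zero_mul, add_zero]
    · rw [pow_succ, Matrix.mul_apply, Fin.sum_univ_two, h01, mul_zero, zero_add, h2, h11, mul_one]
    · rw [pow_succ, Matrix.mul_apply, Fin.sum_univ_two, h3, h1, zero_mul, add_zero, pow_succ]

/-- **An element of `GL₂(𝔽_p)` of exponent `p` fixing `e₀` is the transvection `U(M₀₁)`**: if
`M₁₀ = 0`, `M₀₀ = 1` and `M^p = 1` then `M₁₁ = 1` (as `M₁₁^p = M₁₁` in `𝔽_p`) and `M = T₀₁(M₀₁)`.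
[cite: Serre1972, §2.4 (proof of Prop. 15)] -/
theorem eq_transvection_of_upper_of_pow_eq_one (M : Matrix (Fin 2) (Fin 2) (ZMod p)) (h10 : M 1 0 = 0)
    (h00 : M 0 0 = 1) (hM : M ^ p = 1) : M 1 1 = 1 ∧ M = transvection (0 : Fin 2) 1 (M 0 1) := by
  obtain ⟨-, -, h3⟩ := pow_apply_of_upper M h10 h00 p
  rw [hM, ZMod.pow_card, Matrix.one_apply_eq] at h3
  refine ⟨h3.symm, ?_⟩
  rw [transvection_zero_one_eq]
  ext i j
  fin_cases i <;> fin_cases j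
  · simpa using h00
  · simp
  · simpa using h10
  · simpa using h3.symm

/-- The lower twin: if `M₀₁ = 0`, `M₁₁ = 1` and `M^p = 1` then `M₀₀ = 1` and `M = T₁₀(M₁₀)`.
[cite: Serre1972, §2.4 (proof of Prop. 15)] -/
theorem eq_transvection_of_lower_of_pow_eq_one (M : Matrix (Fin 2) (Fin 2) (ZMod p)) (h01 : M 0 1 = 0)
    (h11 : M 1 1 = 1) (hM : M ^ p = 1) : M 0 0 = 1 ∧ M = transvection (1 : Fin 2) 0 (M 1 0) := by
  obtain ⟨-, -, h3⟩ := pow_apply_of_lower M h01 h11 p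
  rw [hM, ZMod.pow_card, Matrix.one_apply_eq] at h3
  refine ⟨h3.symm, ?_⟩
  rw [transvection_one_zero_eq]
  ext i j
  fin_cases i <;> fin_cases j
  · simpa using h3.symm
  · simpa using h01
  · simp
  · simpa using h11

/-- **An element of exponent `p` of `GL_n(𝔽_p)` fixes a non-zero vector**: `M^p = 1 ⟹ ∃ v ≠ 0, M v = v`
(`(M − 1)^p = M^p − 1 = 0` in characteristic `p`, hence `det(M − 1) = 0`).
[cite: Serre1972, §2.4 (proof of Prop. 15)] -/
theorem exists_mulVec_eq_self_of_pow_eq_one {n : Type*} [DecidableEq n] [Fintype n] [Nonempty n]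
    (M : Matrix n n (ZMod p)) (hM : M ^ p = 1) : ∃ v : n → ZMod p, v ≠ 0 ∧ M *ᵥ v = v := by
  have hnil : (M - 1) ^ p = 0 := by
    rw [sub_pow_char_of_commute p (Commute.one_right M), hM, one_pow, sub_self]
  have hdet : (M - 1).det = 0 := by
    have h := congrArg Matrix.det hnil
    rw [Matrix.det_pow, Matrix.det_zero] at h
    exact pow_eq_zero_iff (hp.out.ne_zero) |>.mp h
  obtain ⟨v, hv0, hv⟩ := Matrix.exists_mulVec_eq_zero_iff.mpr hdet
  refine ⟨v, hv0, ?_⟩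
  rw [Matrix.sub_mulVec, Matrix.one_mulVec, sub_eq_zero] at hv
  exact hv

/-- In `𝔽_p` every element is a natural multiple of any non-zero element (plumbing). [folklore] -/
private theorem exists_nsmul_eq (x : ZMod p) (hx : x ≠ 0) (t : ZMod p) : ∃ n : ℕ, n • x = t := by
  refine ⟨(t * x⁻¹).val, ?_⟩
  rw [nsmul_eq_mul, ZMod.natCast_zmod_val, inv_mul_cancel_right₀ hx]

/-- **Two transvections with distinct axes and a full determinant give all of `GL₂(𝔽_p)`** (the
generation half of Serre's Prop. 15).  Let `ρ : G → M₂(𝔽_p)` be multiplicative on a group `G`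
(`ρ 1 = 1`, `ρ (g h) = ρ g · ρ h`).  If the image contains `U(x) = T₀₁(x)` and `L(w) = T₁₀(w)` with
`x, w ≠ 0` and meets every non-zero determinant, then every matrix with non-zero determinant is in the
image: all `U(t)`, `L(t)` are powers (`𝔽_p` is generated by any non-zero element), `SL₂(𝔽_p)` consists of
words `L U L U` (`exists_word_of_det_eq_one`), and `M = (M · ρ(g)⁻¹) · ρ(g)` with `det ρ(g) = det M`.
[cite: Serre1972, §2.4 Prop. 15] -/
theorem forall_exists_eq_of_transvections {G : Type*} [Group G] (ρ : G → Matrix (Fin 2) (Fin 2) (ZMod p))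
    (hone : ρ 1 = 1) (hmul : ∀ g h, ρ (g * h) = ρ g * ρ h) {x w : ZMod p} (hx : x ≠ 0) (hw : w ≠ 0)
    (h01 : ∃ g, ρ g = transvection (0 : Fin 2) 1 x) (h10 : ∃ g, ρ g = transvection (1 : Fin 2) 0 w)
    (hdet : ∀ u : ZMod p, u ≠ 0 → ∃ g, (ρ g).det = u) :
    ∀ M : Matrix (Fin 2) (Fin 2) (ZMod p), M.det ≠ 0 → ∃ g, ρ g = M := by
  have hpow : ∀ (g : G) (n : ℕ), ρ (g ^ n) = ρ g ^ n := by
    intro g n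
    induction n with
    | zero => rw [pow_zero, pow_zero, hone]
    | succ n ih => rw [pow_succ, hmul, ih, pow_succ]
  -- all upper and lower unipotents are in the image
  have hU : ∀ t : ZMod p, ∃ g, ρ g = transvection (0 : Fin 2) 1 t := by
    intro t
    obtain ⟨g, hg⟩ := h01
    obtain ⟨n, hn⟩ := exists_nsmul_eq x hx t
    exact ⟨g ^ n, by rw [hpow, hg, transvection_pow (by decide), hn]⟩
  have hL : ∀ t : ZMod p, ∃ g, ρ g = transvection (1 : Fin 2) 0 t := by
    intro t
    obtain ⟨g, hg⟩ := h10
    obtain ⟨n, hn⟩ := exists_nsmul_eq w hw t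
    exact ⟨g ^ n, by rw [hpow, hg, transvection_pow (by decide), hn]⟩
  -- hence all of `SL₂(𝔽_p)`
  have hSL : ∀ M : Matrix (Fin 2) (Fin 2) (ZMod p), M.det = 1 → ∃ g, ρ g = M := by
    intro M hM
    obtain ⟨a, r, c, s, h⟩ := exists_word_of_det_eq_one M hM
    obtain ⟨g₁, hg₁⟩ := hL a
    obtain ⟨g₂, hg₂⟩ := hU r
    obtain ⟨g₃, hg₃⟩ := hL c
    obtain ⟨g₄, hg₄⟩ := hU s
    exact ⟨g₁ * (g₂ * g₃ * g₄), by rw [hmul, hmul, hmul, hg₁, hg₂, hg₃, hg₄, ← h]⟩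
  -- and every invertible matrix, adjusting the determinant
  intro M hM
  obtain ⟨g, hg⟩ := hdet M.det hM
  have hinv : ρ g * ρ g⁻¹ = 1 := by rw [← hmul, mul_inv_cancel, hone]
  have hdet' : (ρ g⁻¹).det = M.det⁻¹ := by
    have h := congrArg Matrix.det hinv
    rw [Matrix.det_mul, Matrix.det_one, hg] at h
    exact (eq_inv_of_mul_eq_one_right h)
  have hN : (M * ρ g⁻¹).det = 1 := by rw [Matrix.det_mul, hdet', mul_inv_cancel₀ hM]
  obtain ⟨g', hg'⟩ := hSL _ hN
  refine ⟨g' * g, ?_⟩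
  rw [hmul, hg', Matrix.mul_assoc, ← hmul, inv_mul_cancel, hone, Matrix.mul_one]

end ZMod

end Literature.GroupTheory.DicksonGL2
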